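import Summits.AtomisticToContinuum.FouriersLaw.Theorems.LocalOhmBVBVProfileSeam
import Summits.AtomisticToContinuum.FouriersLaw.Theorems.LocalOhmBVBVProfileProfileBoundContact

/-!
# Crux `BVProfile` (item stmt-AtomisticToContinuum-12012), line `registered`: the ONE-STUB seam
# "bounded TOTAL backflow ⇒ bounded variation", unconditionally

The profile's total variation splits as `Σ_b |θ(b) − θ(b+1)| = (θ(0) − θ(N−1)) + 2·Σ_b (θ(b+1) − θ(b))⁺` (on every bond
`|Δ| = Δ + 2Δ⁻`, and the drops telescope). The telescoped drop `θ(0) − θ(N−1)` is at most `1` for EVERY `N` by the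
landed contact passivity `|θ(0)|, |θ(N−1)| ≤ 1/2` (`profileBound_contact`, `Theorems/LocalOhmBVBVProfileProfileBoundContact.lean`:
Green–Kubo positivity of the conductance, the equilibrium sum rule and the contact identity). Hence the crux
`LocalOhmBV.BVProfile` follows from ONE `N`-uniform statement, with no sup bound / passivity input in the bulk:

* TOTAL BACKFLOW (`stub_totalBackflow`): along any steady-state family (under uniqueness), for every `T > 0` there is `K`
  with `Σ_{all bonds} (θ_N(i+1) − θ_N(i))⁺ ≤ K` for every `N` and every response profile `θ_N` — the profile climbs against
  the imposed (left-hot) gradient only by an `N`-uniformly bounded total amount (boundary layers INCLUDED).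

`bvProfile_of_totalBackflow`: (total-backflow statement) → (BVProfile statement) with `C = 1 + 2·max K 0`; corollaries at
the two route names. The registered two-stub seam (`bvProfile_of_sup_of_backflow`: sup bound × bulk backflow) factors
through it: `totalBackflow_of_sup_of_backflow` (the `≤ 2ℓ` boundary bonds climb at most `2B` each, so
`K_total = K + 4ℓ·max B 0`). No definitions. [folklore]
-/

noncomputable section

open Finset

namespace Summit.AtomisticToContinuum.FouriersLaw.Theorems.BVProfileSeam

/-- The total (all-bonds) backflow double sum `Σ_i Σ_j [j = i+1] (θ j − θ i)⁺`, reindexed over `range (N - 1)` for any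
extension `g : ℕ → ℝ` of `θ`. -/
theorem totalBackflow_sum_eq {N : ℕ} (θ : Fin N → ℝ) (g : ℕ → ℝ) (hg : ∀ i : Fin N, g i.val = θ i) :
    (∑ i : Fin N, ∑ j : Fin N, (if j.val = i.val + 1 then max (θ j - θ i) 0 else 0)) =
      ∑ k ∈ range (N - 1), max (g (k + 1) - g k) 0 := by
  have h1 : (∑ i : Fin N, ∑ j : Fin N, (if j.val = i.val + 1 then max (θ j - θ i) 0 else 0)) =
      ∑ i : Fin N, ∑ j : Fin N, (if j.val = i.val + 1 then max (g j.val - g i.val) 0 else 0) := by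
    refine Finset.sum_congr rfl fun i _ => Finset.sum_congr rfl fun j _ => ?_
    rw [hg, hg]
  have h2 : (∑ a ∈ range N, ∑ b ∈ range N, (if b = a + 1 then max (g b - g a) 0 else 0)) =
      ∑ i : Fin N, ∑ j : Fin N, (if j.val = i.val + 1 then max (g j.val - g i.val) 0 else 0) := by
    simp only [Finset.sum_range]
  have h3 : ∀ a : ℕ, (∑ b ∈ range N, (if b = a + 1 then max (g b - g a) 0 else 0)) =
      if a + 1 < N then max (g (a + 1) - g a) 0 else 0 := by
    intro a
    by_cases ha : a + 1 < N <;> simp [ha, Finset.sum_ite_eq', Finset.mem_range]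
  have h4 : (∑ a ∈ range N, (if a + 1 < N then max (g (a + 1) - g a) 0 else 0)) =
      ∑ k ∈ range (N - 1), max (g (k + 1) - g k) 0 := by
    rw [← Finset.sum_filter]
    refine Finset.sum_congr ?_ fun _ _ => rfl
    ext a
    simp only [Finset.mem_filter, Finset.mem_range]
    omega
  rw [h1, ← h2, Finset.sum_congr rfl fun a _ => h3 a, h4]

/-- **Variation = telescoped drop + twice the backflow**: `Σ_{k<n} |g(k+1) − g(k)| = (g 0 − g n) + 2 Σ_{k<n} (g(k+1) − g k)⁺`
(on each bond `|x| = −x + 2x⁺`, and `Σ (g k − g (k+1))` telescopes). [folklore] -/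
theorem tv_eq_drop_add_two_backflow (g : ℕ → ℝ) (n : ℕ) :
    (∑ k ∈ range n, |g (k + 1) - g k|) = (g 0 - g n) + 2 * ∑ k ∈ range n, max (g (k + 1) - g k) 0 := by
  have habs : ∀ x : ℝ, |x| = -x + 2 * max x 0 := fun x => by
    rcases le_total 0 x with h | h
    · rw [abs_of_nonneg h, max_eq_left h]; ring
    · rw [abs_of_nonpos h, max_eq_right h]; ring
  have htel : (∑ k ∈ range n, (g (k + 1) - g k)) = g n - g 0 := by
    have h := telescope g 0 n
    simpa using h
  calc (∑ k ∈ range n, |g (k + 1) - g k|)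
      = ∑ k ∈ range n, (-(g (k + 1) - g k) + 2 * max (g (k + 1) - g k) 0) :=
        Finset.sum_congr rfl fun k _ => habs _
    _ = -(∑ k ∈ range n, (g (k + 1) - g k)) + 2 * ∑ k ∈ range n, max (g (k + 1) - g k) 0 := by
        rw [Finset.sum_add_distrib, Finset.sum_neg_distrib, Finset.mul_sum]
    _ = (g 0 - g n) + 2 * ∑ k ∈ range n, max (g (k + 1) - g k) 0 := by rw [htel]; ring

/-- **Bulk backflow + bounded edges ⇒ total backflow**: if `|g| ≤ B` pointwise and the positive increments over the
bulk window `Ico ℓ (n - ℓ)` sum to at most `K`, then over `range n` they sum to at most `K + 4ℓB` (the `≤ 2ℓ` edge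
increments are `≤ 2B` each). [folklore] -/
theorem totalBackflow_le_of_sup_of_backflow (g : ℕ → ℝ) (n ℓ : ℕ) (B K : ℝ)
    (hB : ∀ k, |g k| ≤ B)
    (hK : (∑ k ∈ Ico ℓ (n - ℓ), max (g (k + 1) - g k) 0) ≤ K) :
    (∑ k ∈ range n, max (g (k + 1) - g k) 0) ≤ K + 4 * ℓ * B := by
  have hB0 : 0 ≤ B := le_trans (abs_nonneg _) (hB 0)
  have hd : ∀ k, max (g (k + 1) - g k) 0 ≤ 2 * B := fun k => by
    have h1 := abs_le.mp (hB (k + 1))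
    have h2 := abs_le.mp (hB k)
    exact max_le (by linarith [h1.2, h2.1]) (by linarith)
  have hnn : ∀ k, 0 ≤ max (g (k + 1) - g k) 0 := fun k => le_max_right _ _
  have hedge : ∀ s : Finset ℕ, (∑ k ∈ s, max (g (k + 1) - g k) 0) ≤ (s.card : ℝ) * (2 * B) := by
    intro s
    have h := Finset.sum_le_card_nsmul s (fun k => max (g (k + 1) - g k) 0) (2 * B) (fun k _ => hd k)
    simpa [nsmul_eq_mul] using h
  by_cases hℓ : ℓ ≤ n - ℓ
  · have hn : n - ℓ ≤ n := Nat.sub_le n ℓ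
    have hsplit : (∑ k ∈ range n, max (g (k + 1) - g k) 0) =
        (∑ k ∈ Ico 0 ℓ, max (g (k + 1) - g k) 0) + (∑ k ∈ Ico ℓ (n - ℓ), max (g (k + 1) - g k) 0)
          + ∑ k ∈ Ico (n - ℓ) n, max (g (k + 1) - g k) 0 := by
      rw [Finset.range_eq_Ico, ← Finset.sum_Ico_consecutive _ (Nat.zero_le (n - ℓ)) hn,
        ← Finset.sum_Ico_consecutive _ (Nat.zero_le ℓ) hℓ]
    have h1 : (∑ k ∈ Ico 0 ℓ, max (g (k + 1) - g k) 0) ≤ (ℓ : ℝ) * (2 * B) := by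
      have h := hedge (Ico 0 ℓ)
      have hc : ((Ico 0 ℓ).card : ℝ) = ℓ := by
        rw [Nat.card_Ico]; norm_cast
      rw [hc] at h
      exact h
    have h3 : (∑ k ∈ Ico (n - ℓ) n, max (g (k + 1) - g k) 0) ≤ (ℓ : ℝ) * (2 * B) := by
      have h := hedge (Ico (n - ℓ) n)
      have hc : ((Ico (n - ℓ) n).card : ℝ) = ℓ := by
        rw [Nat.card_Ico]; norm_cast; omega
      rw [hc] at h
      exact h
    rw [hsplit]
    linarith [h1, hK, h3]
  · rw [not_le] at hℓ
    have hK0 : 0 ≤ K := by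
      rw [Finset.Ico_eq_empty_of_le hℓ.le, Finset.sum_empty] at hK
      exact hK
    have hn : (n : ℝ) ≤ 2 * ℓ := by norm_cast; omega
    have h := hedge (range n)
    rw [Finset.card_range] at h
    have h5 : (n : ℝ) * (2 * B) ≤ (2 * ℓ) * (2 * B) :=
      mul_le_mul_of_nonneg_right hn (by linarith)
    nlinarith [h, h5, hB0, hK0]

end Summit.AtomisticToContinuum.FouriersLaw.Theorems.BVProfileSeam

namespace Summit.AtomisticToContinuum.FouriersLaw.Theorems

open BVProfileSeam

/-- **The one-stub seam of line `registered`, UNCONDITIONAL**: (total-backflow statement) → (statement of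
`LocalOhmBV.BVProfile`, its definiens VERBATIM), with `C = 1 + 2·max K 0`. For `N ≥ 2` sites:
`Σ_bonds |Δθ| = (θ(0) − θ(N−1)) + 2·(total backflow)` (`tv_eq_drop_add_two_backflow`) and `θ(0) − θ(N−1) ≤ 1` by the
landed `N`-uniform contact passivity `|θ(0)|, |θ(N−1)| ≤ 1/2` (`profileBound_contact`); `N ≤ 1`: no bonds. [folklore] -/
theorem bvProfile_of_totalBackflow : (∀ ω₂ lam β γ : ℝ, 0 < ω₂ → 0 < lam → 0 < β → 0 < γ → (∀ (N : ℕ) (T_L T_R : ℝ), 0 < T_L → 0 < T_R → ∀ μ ν : MeasureTheory.Measure (Literature.MathematicalPhysics.KineticTheory.HeatConduction.PhaseSpace N), (Literature.MathematicalPhysics.KineticTheory.HeatConduction.pinnedChain ω₂ lam β γ).IsSteadyState N T_L T_R μ → (Literature.MathematicalPhysics.KineticTheory.HeatConduction.pinnedChain ω₂ lam β γ).IsSteadyState N T_L T_R ν → μ = ν) → ∀ μ : (N : ℕ) → ℝ → ℝ → MeasureTheory.Measure (Literature.MathematicalPhysics.KineticTheory.HeatConduction.PhaseSpace N), (∀ (N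 : ℕ) (T_L T_R : ℝ), 0 < T_L → 0 < T_R → (Literature.MathematicalPhysics.KineticTheory.HeatConduction.pinnedChain ω₂ lam β γ).IsSteadyState N T_L T_R (μ N T_L T_R)) → ∀ T : ℝ, 0 < T → ∃ K : ℝ, ∀ (N : ℕ) (θ : Fin N → ℝ), (∀ i : Fin N, Filter.Tendsto (fun δ : ℝ => ((∫ x, (x.2 i) ^ 2 ∂(μ N (T + δ / 2) (T - δ / 2))) - ∫ x, (x.2 i) ^ 2 ∂(μ N T T)) / δ) (nhdsWithin 0 {(0 : ℝ)}ᶜ) (nhds (θ i))) → ∑ i : Fin N, ∑ j : Fin N, (if j.val = i.val + 1 then max (θ j - θ i) 0 else 0) ≤ K) → (∀ ω₂ lam β γ : ℝ, 0 < ω₂ → 0 < lam → 0 < β → 0 < γ → (∀ (N : ℕ) (T_L T_R : ℝ), 0 < T_L → 0 < T_R → ∀ μ ν : MeasureTheory.Measure (Literature.MathematicalPhysics.KineticTheory.HeatConduction.PhaseSpace N), (Literature.MathematicalPhysics.KineticTheory.HeatConduction.pinnedChain ω₂ lam β γ).IsSteadyState N T_L T_R μ → (Literature.MathematicalPhysics.KineticTheory.HeatConduction.pinnedChain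 ω₂ lam β γ).IsSteadyState N T_L T_R ν → μ = ν) → ∀ μ : (N : ℕ) → ℝ → ℝ → MeasureTheory.Measure (Literature.MathematicalPhysics.KineticTheory.HeatConduction.PhaseSpace N), (∀ (N : ℕ) (T_L T_R : ℝ), 0 < T_L → 0 < T_R → (Literature.MathematicalPhysics.KineticTheory.HeatConduction.pinnedChain ω₂ lam β γ).IsSteadyState N T_L T_R (μ N T_L T_R)) → ∀ T : ℝ, 0 < T → ∃ C : ℝ, ∀ (N : ℕ) (θ : Fin N → ℝ), (∀ i : Fin N, Filter.Tendsto (fun δ : ℝ => ((∫ x, (x.2 i) ^ 2 ∂(μ N (T + δ / 2) (T - δ / 2))) - ∫ x, (x.2 i) ^ 2 ∂(μ N T T)) / δ) (nhdsWithin 0 {(0 : ℝ)}ᶜ) (nhds (θ i))) → ∑ i : Fin N, ∑ j : Fin N, (if j.val = i.val + 1 then |θ j - θ i| else 0) ≤ C) := by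
  intro hTB ω₂ lam β γ hω hl hβ hγ hU μ hμ T hT
  obtain ⟨K, hK⟩ := hTB ω₂ lam β γ hω hl hβ hγ hU μ hμ T hT
  refine ⟨1 + 2 * max K 0, fun N θ hθ => ?_⟩
  -- the zero extension of the profile
  set g : ℕ → ℝ := fun k => if h : k < N then θ ⟨k, h⟩ else 0 with hg_def
  have hg : ∀ i : Fin N, g i.val = θ i := fun i => by simp [hg_def, i.isLt]
  have hKg : (∑ k ∈ range (N - 1), max (g (k + 1) - g k) 0) ≤ max K 0 := by
    rw [← totalBackflow_sum_eq θ g hg]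
    exact (hK N θ hθ).trans (le_max_left _ _)
  rw [tv_sum_eq θ g hg, tv_eq_drop_add_two_backflow g (N - 1)]
  -- the telescoped drop is at most `1`: contact passivity at both ends (`N ≥ 2`), trivial otherwise
  have hdrop : g 0 - g (N - 1) ≤ 1 := by
    rcases Nat.lt_or_ge N 2 with hN | hN
    · -- `N ≤ 1`: `N - 1 = 0`
      have h0 : N - 1 = 0 := by omega
      rw [h0, sub_self]
      exact zero_le_one
    · have h0N : 0 < N := by omega
      have hlast : N - 1 < N := by omega
      have hc := profileBound_contact ω₂ lam β γ hω hl hβ hγ hU μ hμ T hT N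
      have ha : |θ ⟨0, h0N⟩| ≤ 1 / 2 := hc ⟨0, h0N⟩ (θ ⟨0, h0N⟩) (Or.inl rfl) (hθ ⟨0, h0N⟩)
      have hb : |θ ⟨N - 1, hlast⟩| ≤ 1 / 2 := hc ⟨N - 1, hlast⟩ (θ ⟨N - 1, hlast⟩) (Or.inr rfl) (hθ ⟨N - 1, hlast⟩)
      rw [hg ⟨0, h0N⟩, hg ⟨N - 1, hlast⟩]
      have ha' := abs_le.mp ha
      have hb' := abs_le.mp hb
      linarith [ha'.2, hb'.1]
  have hmax : 0 ≤ max K 0 := le_max_right _ _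
  linarith [hKg, hdrop, hmax]

/-- **The one-stub seam at the crux's name in route `LocalOhmBV`**: (total-backflow statement) → `LocalOhmBV.BVProfile`,
unconditionally. [folklore] -/
theorem localOhmBV_bvProfile_of_totalBackflow
    (hTB : ∀ ω₂ lam β γ : ℝ, 0 < ω₂ → 0 < lam → 0 < β → 0 < γ → (∀ (N : ℕ) (T_L T_R : ℝ), 0 < T_L → 0 < T_R → ∀ μ ν : MeasureTheory.Measure (Literature.MathematicalPhysics.KineticTheory.HeatConduction.PhaseSpace N), (Literature.MathematicalPhysics.KineticTheory.HeatConduction.pinnedChain ω₂ lam β γ).IsSteadyState N T_L T_R μ → (Literature.MathematicalPhysics.KineticTheory.HeatConduction.pinnedChain ω₂ lam β γ).IsSteadyState N T_L T_R ν → μ = ν) → ∀ μ : (N : ℕ) → ℝ → ℝ → MeasureTheory.Measure (Literature.MathematicalPhysics.KineticTheory.HeatConduction.PhaseSpace N), (∀ (N : ℕ) (T_L T_R : ℝ), 0 < T_L → 0 < T_R → (Literature.MathematicalPhysics.KineticTheory.HeatConduction.pinnedChain ω₂ lam β γ).IsSteadyState N T_L T_R (μ N T_L T_R)) → ∀ T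 : ℝ, 0 < T → ∃ K : ℝ, ∀ (N : ℕ) (θ : Fin N → ℝ), (∀ i : Fin N, Filter.Tendsto (fun δ : ℝ => ((∫ x, (x.2 i) ^ 2 ∂(μ N (T + δ / 2) (T - δ / 2))) - ∫ x, (x.2 i) ^ 2 ∂(μ N T T)) / δ) (nhdsWithin 0 {(0 : ℝ)}ᶜ) (nhds (θ i))) → ∑ i : Fin N, ∑ j : Fin N, (if j.val = i.val + 1 then max (θ j - θ i) 0 else 0) ≤ K) :
    _root_.Summit.AtomisticToContinuum.FouriersLaw.Theses.LocalOhmBV.BVProfile :=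
  bvProfile_of_totalBackflow hTB

/-- **The one-stub seam at the crux's sister-route name**: (total-backflow statement) →
`TransferKernelPositivity.BVProfile`, unconditionally. [folklore] -/
theorem transferKernelPositivity_bvProfile_of_totalBackflow
    (hTB : ∀ ω₂ lam β γ : ℝ, 0 < ω₂ → 0 < lam → 0 < β → 0 < γ → (∀ (N : ℕ) (T_L T_R : ℝ), 0 < T_L → 0 < T_R → ∀ μ ν : MeasureTheory.Measure (Literature.MathematicalPhysics.KineticTheory.HeatConduction.PhaseSpace N), (Literature.MathematicalPhysics.KineticTheory.HeatConduction.pinnedChain ω₂ lam β γ).IsSteadyState N T_L T_R μ → (Literature.MathematicalPhysics.KineticTheory.HeatConduction.pinnedChain ω₂ lam β γ).IsSteadyState N T_L T_R ν → μ = ν) → ∀ μ : (N : ℕ) → ℝ → ℝ → MeasureTheory.Measure (Literature.MathematicalPhysics.KineticTheory.HeatConduction.PhaseSpace N), (∀ (N : ℕ) (T_L T_R : ℝ), 0 < T_L → 0 < T_R → (Literature.MathematicalPhysics.KineticTheory.HeatConduction.pinnedChain ω₂ lam β γ).IsSteadyState N T_L T_R (μ N T_L T_R)) → ∀ T : ℝ,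 0 < T → ∃ K : ℝ, ∀ (N : ℕ) (θ : Fin N → ℝ), (∀ i : Fin N, Filter.Tendsto (fun δ : ℝ => ((∫ x, (x.2 i) ^ 2 ∂(μ N (T + δ / 2) (T - δ / 2))) - ∫ x, (x.2 i) ^ 2 ∂(μ N T T)) / δ) (nhdsWithin 0 {(0 : ℝ)}ᶜ) (nhds (θ i))) → ∑ i : Fin N, ∑ j : Fin N, (if j.val = i.val + 1 then max (θ j - θ i) 0 else 0) ≤ K) :
    _root_.Summit.AtomisticToContinuum.FouriersLaw.Theses.TransferKernelPositivity.BVProfile :=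
  bvProfile_of_totalBackflow hTB

/-- **The two registered stubs imply the total-backflow statement** (so the sister-crux reductions still feed the
one-stub seam): sup bound `|θ| ≤ B` and bulk backflow `≤ K` outside layers of width `ℓ` give total backflow
`≤ K + 4ℓ·max B 0` (`totalBackflow_le_of_sup_of_backflow` on the zero-extended profile). [folklore] -/
theorem totalBackflow_of_sup_of_backflow : (∀ ω₂ lam β γ : ℝ, 0 < ω₂ → 0 < lam → 0 < β → 0 < γ → (∀ (N : ℕ) (T_L T_R : ℝ), 0 < T_L → 0 < T_R → ∀ μ ν : MeasureTheory.Measure (Literature.MathematicalPhysics.KineticTheory.HeatConduction.PhaseSpace N), (Literature.MathematicalPhysics.KineticTheory.HeatConduction.pinnedChain ω₂ lam β γ).IsSteadyState N T_L T_R μ → (Literature.MathematicalPhysics.KineticTheory.HeatConduction.pinnedChain ω₂ lam β γ).IsSteadyState N T_L T_R ν → μ = ν) → ∀ μ : (N : ℕ) → ℝ → ℝ → MeasureTheory.Measure (Literature.MathematicalPhysics.KineticTheory.HeatConduction.PhaseSpace N), (∀ (N : ℕ) (T_L T_R : ℝ), 0 < T_L → 0 < T_R → (Literature.MathematicalPhysics.KineticTheory.HeatConduction.pinnedChain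 ω₂ lam β γ).IsSteadyState N T_L T_R (μ N T_L T_R)) → ∀ T : ℝ, 0 < T → ∃ B : ℝ, ∀ (N : ℕ) (i : Fin N) (t : ℝ), Filter.Tendsto (fun δ : ℝ => ((∫ x, (x.2 i) ^ 2 ∂(μ N (T + δ / 2) (T - δ / 2))) - ∫ x, (x.2 i) ^ 2 ∂(μ N T T)) / δ) (nhdsWithin 0 {(0 : ℝ)}ᶜ) (nhds t) → |t| ≤ B) → (∀ ω₂ lam β γ : ℝ, 0 < ω₂ → 0 < lam → 0 < β → 0 < γ → (∀ (N : ℕ) (T_L T_R : ℝ), 0 < T_L → 0 < T_R → ∀ μ ν : MeasureTheory.Measure (Literature.MathematicalPhysics.KineticTheory.HeatConduction.PhaseSpace N), (Literature.MathematicalPhysics.KineticTheory.HeatConduction.pinnedChain ω₂ lam β γ).IsSteadyState N T_L T_R μ → (Literature.MathematicalPhysics.KineticTheory.HeatConduction.pinnedChain ω₂ lam β γ).IsSteadyState N T_L T_R ν → μ = ν) → ∀ μ : (N : ℕ) → ℝ → ℝ → MeasureTheory.Measure (Literature.MathematicalPhysics.KineticTheory.HeatConduction.PhaseSpace N), (∀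 (N : ℕ) (T_L T_R : ℝ), 0 < T_L → 0 < T_R → (Literature.MathematicalPhysics.KineticTheory.HeatConduction.pinnedChain ω₂ lam β γ).IsSteadyState N T_L T_R (μ N T_L T_R)) → ∀ T : ℝ, 0 < T → ∃ (ℓ : ℕ) (K : ℝ), ∀ (N : ℕ) (θ : Fin N → ℝ), (∀ i : Fin N, Filter.Tendsto (fun δ : ℝ => ((∫ x, (x.2 i) ^ 2 ∂(μ N (T + δ / 2) (T - δ / 2))) - ∫ x, (x.2 i) ^ 2 ∂(μ N T T)) / δ) (nhdsWithin 0 {(0 : ℝ)}ᶜ) (nhds (θ i))) → ∑ i : Fin N, ∑ j : Fin N, (if j.val = i.val + 1 ∧ ℓ ≤ i.val ∧ i.val + 1 + ℓ < N then max (θ j - θ i) 0 else 0) ≤ K) → (∀ ω₂ lam β γ : ℝ, 0 < ω₂ → 0 < lam → 0 < β → 0 < γ → (∀ (N : ℕ) (T_L T_R : ℝ), 0 < T_L → 0 < T_R → ∀ μ ν : MeasureTheory.Measure (Literature.MathematicalPhysics.KineticTheory.HeatConduction.PhaseSpace N), (Literature.MathematicalPhysics.KineticTheory.HeatConduction.pinnedChain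 ω₂ lam β γ).IsSteadyState N T_L T_R μ → (Literature.MathematicalPhysics.KineticTheory.HeatConduction.pinnedChain ω₂ lam β γ).IsSteadyState N T_L T_R ν → μ = ν) → ∀ μ : (N : ℕ) → ℝ → ℝ → MeasureTheory.Measure (Literature.MathematicalPhysics.KineticTheory.HeatConduction.PhaseSpace N), (∀ (N : ℕ) (T_L T_R : ℝ), 0 < T_L → 0 < T_R → (Literature.MathematicalPhysics.KineticTheory.HeatConduction.pinnedChain ω₂ lam β γ).IsSteadyState N T_L T_R (μ N T_L T_R)) → ∀ T : ℝ, 0 < T → ∃ K : ℝ, ∀ (N : ℕ) (θ : Fin N → ℝ), (∀ i : Fin N, Filter.Tendsto (fun δ : ℝ => ((∫ x, (x.2 i) ^ 2 ∂(μ N (T + δ / 2) (T - δ / 2))) - ∫ x, (x.2 i) ^ 2 ∂(μ N T T)) / δ) (nhdsWithin 0 {(0 : ℝ)}ᶜ) (nhds (θ i))) → ∑ i : Fin N, ∑ j : Fin N, (if j.val = i.val + 1 then max (θ j - θ i) 0 else 0) ≤ K) := by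
  intro hPB hBF ω₂ lam β γ hω hl hβ hγ hU μ hμ T hT
  obtain ⟨B, hB⟩ := hPB ω₂ lam β γ hω hl hβ hγ hU μ hμ T hT
  obtain ⟨ℓ, K, hK⟩ := hBF ω₂ lam β γ hω hl hβ hγ hU μ hμ T hT
  refine ⟨K + 4 * ℓ * max B 0, fun N θ hθ => ?_⟩
  set g : ℕ → ℝ := fun k => if h : k < N then θ ⟨k, h⟩ else 0 with hg_def
  have hg : ∀ i : Fin N, g i.val = θ i := fun i => by simp [hg_def, i.isLt]
  have hgB : ∀ k, |g k| ≤ max B 0 := by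
    intro k
    by_cases hk : k < N
    · rw [hg ⟨k, hk⟩]
      exact (hB N ⟨k, hk⟩ (θ ⟨k, hk⟩) (hθ ⟨k, hk⟩)).trans (le_max_left _ _)
    · have h0 : g k = 0 := by simp [hg_def, hk]
      rw [h0, abs_zero]
      exact le_max_right _ _
  have hKg : (∑ k ∈ Ico ℓ (N - 1 - ℓ), max (g (k + 1) - g k) 0) ≤ K := by
    rw [← backflow_sum_eq θ g hg ℓ]
    exact hK N θ hθ
  rw [totalBackflow_sum_eq θ g hg]
  exact totalBackflow_le_of_sup_of_backflow g (N - 1) ℓ (max B 0) K hgB hKg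

end Summit.AtomisticToContinuum.FouriersLaw.Theorems

end
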